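import Summits.Ventures.HodgeRepro2.T5FinitePlaceStar
import Summits.Ventures.HodgeRepro2.T5CMTotallyNegative

/-!
# The finite places of a CM field in Mathlib's vocabulary: `K_w / K⁺_v`, split ⟺ `θ` a `v`-adic square,
the local complex conjugation (cell pub-hodge-repro2, seat p3)

Tier-5 N2 support, §N2.9.2 of route/T5-N2-route-3.md («completions») at the finite places — THE INSTANTIATION of
files 115–119 on Mathlib's `NumberField.IsCMField K` (`K⁺ = maximalRealSubfield K`, `c = IsCMField.complexConj K`,
`star = c`), with the datum of file 103 (`y ∈ K`, `c y ≠ y`, `θ ∈ K⁺` with `θ = y²` — B1 l. 22's `F = F⁺(√θ)`):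
`span_pair_eq_top` (`K = K⁺ + K⁺ y`), `complexConj_apply_eq_neg` (`c y = −y`), and for a finite place `v` of `K⁺`
and `w ∣ v` of `K`: `finrank_eq_one_iff_isSquare` / `finrank_eq_two_iff_not_isSquare` (`w` is split over `v`
⟺ `θ` is a `v`-adic square), `isGalois` at a non-split place, the LOCAL COMPLEX CONJUGATION
`localComplexConj : K_w ≃ₐ[K⁺_v] K_w` extending `c` (`localComplexConj_algebraMap`), `K_w` as a star-field whose
`star` extends Mathlib's CM `star` (`star_algebraMap`), and the local norm `N_{K_w/K⁺_v}` extending `N_{K/K⁺}`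
(`norm_algebraMap`). Mathlib + files 103, 115–119 only. No display; no device.
§8(d): uses an L-value-free non-vanishing device: NO.
-/

namespace Summit.Ventures.HodgeRepro2.T5FinitePlaceCM

open IsDedekindDomain IsDedekindDomain.HeightOneSpectrum NumberField NumberField.IsCMField Module
open scoped Summit.Ventures.HodgeRepro2.T5FinitePlaceLiesOver
open Summit.Ventures.HodgeRepro2.T5FinitePlaceLiesOver Summit.Ventures.HodgeRepro2.T5FinitePlaceQuadratic
  Summit.Ventures.HodgeRepro2.T5FinitePlaceTensorEquiv Summit.Ventures.HodgeRepro2.T5FinitePlaceLocalNorm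
  Summit.Ventures.HodgeRepro2.T5FinitePlaceStar Summit.Ventures.HodgeRepro2.T5CMTotallyNegative

variable (K : Type*) [Field K] [NumberField K] [IsCMField K]

section Generator

variable {y : K}

/-- An element of the CM field `K` not fixed by `c` is not in `K⁺`. -/
theorem notMem_maximalRealSubfield (hy : complexConj K y ≠ y) : y ∉ maximalRealSubfield K :=
  fun h => hy ((complexConj_eq_self_iff K y).mpr h)

/-- `1, y` are `K⁺`-linearly independent when `y ∉ K⁺`. -/
theorem linearIndependent_one_y (hy : complexConj K y ≠ y) :
    LinearIndependent (maximalRealSubfield K) ![(1 : K), y] := by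
  rw [LinearIndependent.pair_iff]
  intro a b hab
  by_cases hb : b = 0
  · subst hb
    rw [zero_smul, add_zero, smul_eq_zero] at hab
    exact ⟨hab.resolve_right one_ne_zero, rfl⟩
  · exfalso
    apply notMem_maximalRealSubfield K hy
    have h1 : b • y = -(a • (1 : K)) := eq_neg_of_add_eq_zero_right hab
    have h2 : y = b⁻¹ • (b • y) := (inv_smul_smul₀ hb y).symm
    rw [h1, smul_neg, smul_smul, Algebra.smul_def, mul_one] at h2
    rw [h2]
    exact neg_mem (SetLike.coe_mem (b⁻¹ * a))

/-- **`K = K⁺ + K⁺ y`** for any `y` with `c y ≠ y` (`[K : K⁺] = 2`). -/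
theorem span_pair_eq_top (hy : complexConj K y ≠ y) :
    Submodule.span (maximalRealSubfield K) {(1 : K), y} = ⊤ := by
  apply Submodule.eq_top_of_finrank_eq
  have hrange : Set.range ![(1 : K), y] = {(1 : K), y} := by
    ext x
    simp only [Set.mem_range, Fin.exists_fin_two, Matrix.cons_val_zero, Matrix.cons_val_one,
      Set.mem_insert_iff, Set.mem_singleton_iff]
    exact ⟨fun h => h.elim (fun h => Or.inl h.symm) (fun h => Or.inr h.symm),
      fun h => h.elim (fun h => Or.inl h.symm) (fun h => Or.inr h.symm)⟩
  rw [← hrange, finrank_span_eq_card (linearIndependent_one_y K hy),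
    Algebra.IsQuadraticExtension.finrank_eq_two (maximalRealSubfield K) K, Fintype.card_fin]

variable {θ : maximalRealSubfield K}

/-- `c y = −y` for the datum `θ = y²` (file 103's `complexConj_eq_neg`). -/
theorem complexConj_apply_eq_neg (hθ : algebraMap (maximalRealSubfield K) K θ = y ^ 2)
    (hy : complexConj K y ≠ y) : complexConj K y = -y :=
  complexConj_eq_neg K hy (by rw [← hθ]; exact complexConj_apply_eq_self K θ)

end Generator

section Places

variable {θ : maximalRealSubfield K} {y : K}
variable (hθ : algebraMap (maximalRealSubfield K) K θ = y ^ 2) (hy : complexConj K y ≠ y)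
variable (v : HeightOneSpectrum (𝓞 (maximalRealSubfield K))) (w : HeightOneSpectrum (𝓞 K))
  [w.asIdeal.LiesOver v.asIdeal]

include hθ hy in
/-- **`w` is split over `v` (`K_w = K⁺_v`) ⟺ `θ` is a `v`-adic square.** -/
theorem finrank_eq_one_iff_isSquare :
    finrank (v.adicCompletion (maximalRealSubfield K)) (w.adicCompletion K) = 1 ↔
      IsSquare (algebraMap (maximalRealSubfield K) (v.adicCompletion (maximalRealSubfield K)) θ) :=
  T5FinitePlaceQuadratic.finrank_eq_one_iff_isSquare v w hθ.symm (span_pair_eq_top K hy)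

include hθ hy in
/-- **`[K_w : K⁺_v] = 2` ⟺ `θ` is not a `v`-adic square.** -/
theorem finrank_eq_two_iff_not_isSquare :
    finrank (v.adicCompletion (maximalRealSubfield K)) (w.adicCompletion K) = 2 ↔
      ¬ IsSquare (algebraMap (maximalRealSubfield K) (v.adicCompletion (maximalRealSubfield K)) θ) :=
  T5FinitePlaceQuadratic.finrank_eq_two_iff_not_isSquare v w hθ.symm (span_pair_eq_top K hy)

include hy in
/-- `[K_w : K⁺_v] ∈ {1, 2}`. -/
theorem finrank_eq_one_or_two :
    finrank (v.adicCompletion (maximalRealSubfield K)) (w.adicCompletion K) = 1 ∨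
      finrank (v.adicCompletion (maximalRealSubfield K)) (w.adicCompletion K) = 2 :=
  T5FinitePlaceQuadratic.finrank_eq_one_or_two v w (span_pair_eq_top K hy)

variable (hsq : ¬ IsSquare (algebraMap (maximalRealSubfield K) (v.adicCompletion (maximalRealSubfield K)) θ))

include hθ hy hsq in
/-- `K_w / K⁺_v` is Galois at a non-split place. -/
theorem isGalois : IsGalois (v.adicCompletion (maximalRealSubfield K)) (w.adicCompletion K) :=
  T5FinitePlaceLocalNorm.isGalois v w hθ.symm (span_pair_eq_top K hy) hsq (complexConj K)
    (complexConj_apply_eq_neg K hθ hy)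

/-- **The local complex conjugation** of `K_w` over `K⁺_v` at a non-split place: the extension of
`IsCMField.complexConj K`. -/
noncomputable def localComplexConj :
    w.adicCompletion K ≃ₐ[v.adicCompletion (maximalRealSubfield K)] w.adicCompletion K :=
  extendAutOfNotIsSquare v w hθ.symm (span_pair_eq_top K hy) hsq (complexConj K)

/-- The local complex conjugation extends `c` (= Mathlib's `star` on `K`). -/
theorem localComplexConj_algebraMap (x : K) :
    localComplexConj K hθ hy v w hsq (algebraMap K (w.adicCompletion K) x) =
      algebraMap K (w.adicCompletion K) (complexConj K x) :=
  extendAutOfNotIsSquare_algebraMap v w hθ.symm (span_pair_eq_top K hy) hsq (complexConj K) x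

/-- `localComplexConj (y) = −y`. -/
theorem localComplexConj_algebraMap_y :
    localComplexConj K hθ hy v w hsq (algebraMap K (w.adicCompletion K) y) =
      -(algebraMap K (w.adicCompletion K) y) :=
  extendAutOfNotIsSquare_apply_s v w hθ.symm (span_pair_eq_top K hy) hsq (complexConj K)
    (complexConj_apply_eq_neg K hθ hy)

/-- The local complex conjugation is an involution. -/
theorem localComplexConj_localComplexConj (z : w.adicCompletion K) :
    localComplexConj K hθ hy v w hsq (localComplexConj K hθ hy v w hsq z) = z :=
  extendAutOfNotIsSquare_extendAutOfNotIsSquare v w hθ.symm (span_pair_eq_top K hy) hsq (complexConj K)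
    (trans_self_eq_refl_of_apply_s_eq_neg (span_pair_eq_top K hy) (complexConj K)
      (complexConj_apply_eq_neg K hθ hy)) z

/-- **`N_{K_w/K⁺_v}(z) = z · c_w(z)`.** -/
theorem algebraMap_norm_eq_mul_localComplexConj (z : w.adicCompletion K) :
    algebraMap (v.adicCompletion (maximalRealSubfield K)) (w.adicCompletion K)
        (Algebra.norm (v.adicCompletion (maximalRealSubfield K)) z) =
      z * localComplexConj K hθ hy v w hsq z :=
  algebraMap_norm_eq_mul_localConj v w hθ.symm (span_pair_eq_top K hy) hsq (complexConj K)
    (complexConj_apply_eq_neg K hθ hy) z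

include hθ hy hsq in
/-- **The local norm extends the CM norm `N_{K/K⁺}`** at a non-split place. -/
theorem norm_algebraMap (x : K) :
    Algebra.norm (v.adicCompletion (maximalRealSubfield K)) (algebraMap K (w.adicCompletion K) x) =
      algebraMap (maximalRealSubfield K) (v.adicCompletion (maximalRealSubfield K))
        (Algebra.norm (maximalRealSubfield K) x) :=
  norm_algebraMap_of_not_isSquare v w hθ.symm (span_pair_eq_top K hy) hsq x

/-- **`K_w` as a star-field** with `star = localComplexConj` (a definition, never an instance). -/
noncomputable abbrev localStarRing : StarRing (w.adicCompletion K) :=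
  T5FinitePlaceStar.localStarRing v w hθ.symm (span_pair_eq_top K hy) hsq (complexConj K)
    (complexConj_apply_eq_neg K hθ hy)

/-- **The local `star` extends Mathlib's CM `star`:** `star (x) = (star x)` for `x ∈ K`. -/
theorem star_algebraMap (x : K) :
    letI := localStarRing K hθ hy v w hsq
    star (algebraMap K (w.adicCompletion K) x) = algebraMap K (w.adicCompletion K) (star x) :=
  localComplexConj_algebraMap K hθ hy v w hsq x

/-- `star` fixes `K⁺_v`, and only `K⁺_v`. -/
theorem star_eq_self_iff (z : w.adicCompletion K) :
    letI := localStarRing K hθ hy v w hsq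
    star z = z ↔
      z ∈ (algebraMap (v.adicCompletion (maximalRealSubfield K)) (w.adicCompletion K)).range :=
  T5FinitePlaceStar.star_eq_self_iff v w hθ.symm (span_pair_eq_top K hy) hsq (complexConj K)
    (complexConj_apply_eq_neg K hθ hy) z

end Places

end Summit.Ventures.HodgeRepro2.T5FinitePlaceCM
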